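import Mathlib
import Summits.Ventures.PercRepro2.LocRows
import Summits.Ventures.PercRepro2.SwRow
import Summits.Ventures.PercRepro2.SwOut
import Summits.Ventures.PercRepro2.SwAllRow
import Summits.Ventures.PercRepro2.SwOutAll
import Summits.Ventures.PercRepro2.SwOutArmFlip
import Summits.Ventures.PercRepro2.SwOutArmThm
import Summits.Ventures.PercRepro2.SwOutCoreDefs
import Summits.Ventures.PercRepro2.SwOutCoreHull
import Summits.Ventures.PercRepro2.SwOutEdgeDefs

/-!
# The e-core cube: the hull formula (blind cell PercRepro2, night-4 g16, 2026-08-26;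
proofs/NIGHT4-G15.md §4 (L1), proofs/NIGHT4-G16.md §1)

For an e-core base (`CoreBaseE`, the junction `u` adjacent to `h`) and a cube point
`ω : Config (Option ι)`, the red cluster of `h` of the realisation `coreRealE ζ ω` is exactly
`redSetE ω`: `h`, the red h-arms and — when the h–u edges are red (`ω none = true`) or some red
h-arm is adjacent to `u` — `u` with the red pure arms (`cluster_coreRealE`).  Proof as for the
core cube (`SwOutCoreHull`): `redSetE ω` is closed under red adjacency (`redSetE_closed`: a red
edge at `h` is a red h–u edge, which puts `u` in, or enters a red h-arm; a red edge leaving a red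
arm ends at `h`, at `u` or outside the hull, where the base colouring makes it blue), and every
vertex of it is red-connected to `h` (`u` through a red h–u edge or a red u-adjacent h-arm).  The
envelope `redAll (ω ∘ some) = {h, u} ∪ red arms` is red-closed at every cube point whatever the
colour of the h–u edges (`redAll_closed`).
-/

namespace Summit.Ventures.PercRepro2

namespace LocRows

open Hull

variable {V : Type*} {E : Type*}

open scoped Classical

variable {ends : E → Sym2 V}

section Hull

variable {ι : Type*} {A : ι → Set V} {pure : ι → Prop} {ζ : Config E} {h u : V} {H : Set V}
  (hb : CoreBaseE ends ζ h u H A pure)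
include hb

/-- `redAll (ω ∘ some) ⊆ H`. -/
lemma CoreBaseE.redAll_subset (ω : Config (Option ι)) : redAll A h u (ω ∘ some) ⊆ H := by
  intro x hx
  rw [mem_redAll_iff] at hx
  rcases hx with rfl | rfl | ⟨i, _, hx⟩
  · exact hb.h_mem
  · exact hb.u_mem
  · exact (hb.arm_sub i x hx).1

/-- `redSetE ω ⊆ H`. -/
lemma CoreBaseE.redSetE_subset (ω : Config (Option ι)) : redSetE ends A h u pure ω ⊆ H :=
  (redSetE_subset_redAll ω).trans (hb.redAll_subset ω)

/-- A red edge of a realisation leaving `A i` (with `A i` red) ends at `h` or at `u`. -/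
lemma CoreBaseE.end_of_red_of_mem_arm {ω : Config (Option ι)} {i : ι} (hi : ω (some i) = true)
    {e : E} {a b : V} (hends : ends e = s(a, b)) (ha : a ∈ A i)
    (he : coreRealE ends A h u ζ ω e = true) : b ∈ A i ∨ b = h ∨ b = u := by
  by_cases hbH : b ∈ H
  · by_cases hbh : b = h
    · exact Or.inr (Or.inl hbh)
    by_cases hbu : b = u
    · exact Or.inr (Or.inr hbu)
    obtain ⟨j, hbj⟩ := hb.arm_cover b hbH hbh hbu
    have hij : i = j := hb.arm_eq_of_edge hends ha hbj
    subst hij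
    exact Or.inl hbj
  · exfalso
    have h1 := hb.bdry_blue e a b hends (hb.arm_sub i a ha).1 hbH
    rw [hb.coreRealE_apply_of_mem hends ha, if_pos hi, h1] at he
    exact absurd he (by decide)

/-- A red edge of a realisation at `h` is a red h–u edge (`ω none = true`) or enters a red
h-arm. -/
lemma CoreBaseE.red_of_red_at_h {ω : Config (Option ι)} {e : E} {b : V}
    (hends : ends e = s(h, b)) (he : coreRealE ends A h u ζ ω e = true) :
    (b = u ∧ ω none = true) ∨ ∃ j, ω (some j) = true ∧ ¬ pure j ∧ b ∈ A j := by
  rcases hb.h_edges e b hends with hbu | ⟨j, hbj⟩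
  · left
    refine ⟨hbu, ?_⟩
    have hends' : ends e = s(h, u) := by rw [hends, hbu]
    rw [CoreBaseE.coreRealE_apply_hu (A := A) (ζ := ζ) hends'] at he
    by_contra hn
    rw [if_neg hn, hb.hu_red hends'] at he
    exact absurd he (by decide)
  · right
    refine ⟨j, ?_, fun hp => hb.pure_no_h j hp e b hends hbj, hbj⟩
    rw [hb.coreRealE_apply_of_mem (ends_swap hends) hbj, hb.h_red e b hends] at he
    by_contra hj
    rw [if_neg hj] at he
    exact absurd he (by decide)

/-- A red edge of a realisation at `u` is a red h–u edge (`ω none = true`) or enters a red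
arm. -/
lemma CoreBaseE.red_of_red_at_u {ω : Config (Option ι)} {e : E} {b : V}
    (hends : ends e = s(u, b)) (he : coreRealE ends A h u ζ ω e = true) :
    (b = h ∧ ω none = true) ∨ ∃ j, ω (some j) = true ∧ b ∈ A j := by
  rcases hb.u_edges e b hends with hbh | ⟨j, hbj⟩
  · left
    refine ⟨hbh, ?_⟩
    have hends' : ends e = s(h, u) := by rw [hends, hbh, Sym2.eq_swap]
    rw [CoreBaseE.coreRealE_apply_hu (A := A) (ζ := ζ) hends'] at he
    by_contra hn
    rw [if_neg hn, hb.hu_red hends'] at he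
    exact absurd he (by decide)
  · right
    refine ⟨j, ?_, hbj⟩
    rw [hb.coreRealE_apply_of_mem (ends_swap hends) hbj, hb.u_red e b hends] at he
    by_contra hj
    rw [if_neg hj] at he
    exact absurd he (by decide)

/-- **`redAll (ω ∘ some)` is closed under red adjacency** at every cube point. -/
theorem CoreBaseE.redAll_closed (ω : Config (Option ι)) :
    ∀ a ∈ redAll A h u (ω ∘ some), ∀ b,
      (openGraph ends (coreRealE ends A h u ζ ω)).Adj a b → b ∈ redAll A h u (ω ∘ some) := by
  intro a ha b hab
  obtain ⟨_, e, he, hends⟩ := openGraph_adj.1 hab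
  rw [mem_redAll_iff] at ha ⊢
  rcases ha with rfl | rfl | ⟨i, hi, ha⟩
  · rcases hb.red_of_red_at_h hends he with ⟨hbu, _⟩ | ⟨j, hj, _, hbj⟩
    · exact Or.inr (Or.inl hbu)
    · exact Or.inr (Or.inr ⟨j, hj, hbj⟩)
  · rcases hb.red_of_red_at_u hends he with ⟨hbh, _⟩ | ⟨j, hj, hbj⟩
    · exact Or.inl hbh
    · exact Or.inr (Or.inr ⟨j, hj, hbj⟩)
  · rcases hb.end_of_red_of_mem_arm hi hends ha he with hbi | hbh | hbu
    · exact Or.inr (Or.inr ⟨i, hi, hbi⟩)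
    · exact Or.inl hbh
    · exact Or.inr (Or.inl hbu)

/-- **`redSetE ω` is closed under red adjacency.** -/
theorem CoreBaseE.redSetE_closed (ω : Config (Option ι)) :
    ∀ a ∈ redSetE ends A h u pure ω, ∀ b,
      (openGraph ends (coreRealE ends A h u ζ ω)).Adj a b → b ∈ redSetE ends A h u pure ω := by
  intro a ha b hab
  obtain ⟨_, e, he, hends⟩ := openGraph_adj.1 hab
  rw [mem_redSetE_iff] at ha ⊢
  rcases ha with rfl | ⟨i, hi, hpi, ha⟩ | ⟨hu, rfl | ⟨i, hi, hpi, ha⟩⟩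
  · -- from `h`: to `u` by a red h–u edge, or into a red h-arm
    rcases hb.red_of_red_at_h hends he with ⟨hbu, hn⟩ | ⟨j, hj, hpj, hbj⟩
    · exact Or.inr (Or.inr ⟨Or.inl hn, Or.inl hbu⟩)
    · exact Or.inr (Or.inl ⟨j, hj, hpj, hbj⟩)
  · -- from a red h-arm: inside it, to `h`, or to `u` (which is then red)
    rcases hb.end_of_red_of_mem_arm hi hends ha he with hbi | hbh | hbu
    · exact Or.inr (Or.inl ⟨i, hi, hpi, hbi⟩)
    · exact Or.inl hbh
    · subst hbu
      exact Or.inr (Or.inr ⟨Or.inr ⟨i, hi, hpi, e, a, ends_swap hends, ha⟩, Or.inl rfl⟩)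
  · -- from `u` (red): to `h`, or into a red arm
    rcases hb.red_of_red_at_u hends he with ⟨hbh, _⟩ | ⟨j, hj, hbj⟩
    · exact Or.inl hbh
    · by_cases hpj : pure j
      · exact Or.inr (Or.inr ⟨hu, Or.inr ⟨j, hj, hpj, hbj⟩⟩)
      · exact Or.inr (Or.inl ⟨j, hj, hpj, hbj⟩)
  · -- from a red pure arm (with `u` red): inside it or to `u`
    rcases hb.end_of_red_of_mem_arm hi hends ha he with hbi | hbh | hbu
    · exact Or.inr (Or.inr ⟨hu, Or.inr ⟨i, hi, hpi, hbi⟩⟩)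
    · exfalso
      subst hbh
      exact hb.pure_no_h i hpi e a (ends_swap hends) ha
    · exact Or.inr (Or.inr ⟨hu, Or.inl hbu⟩)

/-- Every vertex of a red h-arm lies in the red cluster of `h` of the realisation. -/
lemma CoreBaseE.mem_cluster_of_harm {ω : Config (Option ι)} {i : ι} (hi : ω (some i) = true)
    (hpi : ¬ pure i) {x : V} (hx : x ∈ A i) : x ∈ cluster ends (coreRealE ends A h u ζ ω) h :=
  cluster_mono (hb.insideConfig_le_coreRealE hi (Or.inl rfl)) h (hb.harm_conn i hpi x hx)

/-- When the h–u edges are red or some red h-arm is adjacent to `u`, `u` lies in the red cluster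
of `h`. -/
lemma CoreBaseE.u_mem_cluster_of_uRedE {ω : Config (Option ι)} (hu : uRedE ends A u pure ω) :
    u ∈ cluster ends (coreRealE ends A h u ζ ω) h := by
  rcases hu with hn | ⟨i, hi, hpi, e, x, hux, hx⟩
  · obtain ⟨e, he⟩ := hb.hu_exists
    refine mem_cluster_of_edge (mem_cluster_self _ _ _) ?_ he
    rw [CoreBaseE.coreRealE_apply_hu (A := A) (ζ := ζ) he, if_pos hn]
    exact hb.hu_red he
  · have hi' : ω (some i) = true := hi
    have hxT := hb.mem_cluster_of_harm hi' hpi hx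
    refine mem_cluster_of_edge hxT ?_ (ends_swap hux)
    rw [hb.coreRealE_apply_of_mem (ends_swap hux) hx, if_pos hi']
    exact hb.u_red e x hux

/-- Every vertex of a red pure arm lies in the red cluster of `h` when `u` is red. -/
lemma CoreBaseE.mem_cluster_of_pure {ω : Config (Option ι)} (hu : uRedE ends A u pure ω) {i : ι}
    (hi : ω (some i) = true) (hpi : pure i) {x : V} (hx : x ∈ A i) :
    x ∈ cluster ends (coreRealE ends A h u ζ ω) h := by
  have h1 : x ∈ cluster ends (coreRealE ends A h u ζ ω) u :=
    cluster_mono (hb.insideConfig_le_coreRealE hi (Or.inr rfl)) u (hb.pure_conn i hpi x hx)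
  exact conn_trans (hb.u_mem_cluster_of_uRedE hu) h1

/-- **The hull formula**: the red cluster of `h` of a cube point is `redSetE ω`. -/
theorem CoreBaseE.cluster_coreRealE (ω : Config (Option ι)) :
    cluster ends (coreRealE ends A h u ζ ω) h = redSetE ends A h u pure ω := by
  apply Set.Subset.antisymm
  · intro v hv
    exact mem_of_conn_of_closed (hb.redSetE_closed ω)
      (by rw [mem_redSetE_iff]; exact Or.inl rfl) hv
  · intro v hv
    rw [mem_redSetE_iff] at hv
    rcases hv with rfl | ⟨i, hi, hpi, hv⟩ | ⟨hu, rfl | ⟨i, hi, hpi, hv⟩⟩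
    · exact mem_cluster_self _ _ _
    · exact hb.mem_cluster_of_harm hi hpi hv
    · exact hb.u_mem_cluster_of_uRedE hu
    · exact hb.mem_cluster_of_pure hu hi hpi hv

/-- The red cluster of `h` of a cube point lies in `H`. -/
lemma CoreBaseE.cluster_coreRealE_subset (ω : Config (Option ι)) :
    cluster ends (coreRealE ends A h u ζ ω) h ⊆ H := by
  rw [hb.cluster_coreRealE]; exact hb.redSetE_subset ω

/-- The red cluster of `h` grows with the cube point. -/
lemma CoreBaseE.cluster_coreRealE_mono {ω ω' : Config (Option ι)} (hω : ω ≤ ω') :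
    cluster ends (coreRealE ends A h u ζ ω) h ⊆ cluster ends (coreRealE ends A h u ζ ω') h := by
  rw [hb.cluster_coreRealE, hb.cluster_coreRealE]; exact redSetE_mono hω

end Hull

end LocRows

end Summit.Ventures.PercRepro2
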